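import Summits.BirchSwinnertonDyer.BirchSwinnertonDyer.Theses.BiquadraticEisensteinDescent
import Summits.BirchSwinnertonDyer.Rank1Residual.X11b.BDPRouteOpenInputIdealRigidity
import Summits.BirchSwinnertonDyer.Rank1Residual.X11b.AnticyclotomicModuleFinite
import Summits.BirchSwinnertonDyer.BirchSwinnertonDyer.Theorems.BiquadraticEisensteinDescentEisensteinHeartFlatCMInertBadKPrimeCMDatumAdapter
import Summits.BirchSwinnertonDyer.BirchSwinnertonDyer.Theorems.BiquadraticEisensteinDescentEisensteinHeartFlatCMInertBadKPrimeSqrtEndomorphismAllJ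
import Summits.BirchSwinnertonDyer.BirchSwinnertonDyer.Theorems.BiquadraticEisensteinDescentEisensteinHeartFlatCMInertBadKPrimeKatzHsiehSocket
import Summits.BirchSwinnertonDyer.BirchSwinnertonDyer.Theorems.BiquadraticEisensteinDescentEisensteinHeartFlatCMInertBadKPrimeCuspCoeffVanishing
import Summits.BirchSwinnertonDyer.BirchSwinnertonDyer.Theorems.BiquadraticEisensteinDescentEisensteinHeartFlatCMInertBadKPrimeConstantScaling
import HarnessLib
import Summits.BirchSwinnertonDyer.BirchSwinnertonDyer.Theorems.BiquadraticEisensteinDescentEisensteinHeartFlatCMInertBadKPrimeOfV4K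

/-!
# PROMOTE-STUB-V4K — CERTIFICATE for the gen-2 split of crux `EisensteinHeartFlatCMInertBadKPrime` (stmt-BirchSwinnertonDyer-21341)

Lead-prover seat `bsd-wall-cm-bed-p1` g2 (2026-08-28). Crux workfile (no `sorry`), companion of `PROMOTE-STUB-V4K.md` (lead g1):
* `EisensteinDivisibilityKatzLineCMInertBad : Prop` := the registered signature of `stub_V4K` of line `hsieh_lambda` v3
  (skeleton sha16 cc08ae1089e5f3a0) VERBATIM — the text the BED pen is asked to file as the new CRUX CHILD of 21341
  (Hsieh JAMS 27 (2014) Thm 8.14's object for the branch `Ψ = ψ_W∘N_{L/K_CM}` of the biquadratic CM field `L = K′·K_CM`,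
  `Σ_p = {𝔓′}`, restricted to the `K′`-anticyclotomic (self-dual) line and read in `Λ ⊗ ℚ`; NOT in print on the `p`-ramified
  tame branch — research residue (I′)/`J_{v₀}`, see HSIEH-AWAY-FROM-P-AUDIT*.md, JV0-LOCAL-SPEC.md);
* `eisensteinHeartFlatCMInertBadKPrime_of_inputs` : (A) Hsieh Thm A any level → (Katz) `hsieh2014mu_prop49_exists_isMeasure` →
  (Deuring) `Deuring_exists_heckeCharacter_of_maximalCM` → `EisensteinDivisibilityKatzLineCMInertBad` → the crux BY NAME —
  a one-line wrapper of the landed reduction p647756 `…OfV4K.eisensteinHeartFlatCMInertBadKPrime_of_V4K_of_facts` = the GLUE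
  item of the split, kernel-checked against the def (so the route edit is copy-paste: child signature = the body of the def below,
  fully qualified as printed by `#print`, glue closer = this theorem).
Nothing here is a theorem about BSD; the def is a research statement (conjecture-status), deliberately NOT a Literature fact.
-/

set_option linter.dupNamespace false
set_option autoImplicit false

noncomputable section

open scoped Classical NumberField

open WeierstrassCurve NumberField IsDedekindDomain Field PowerSeries
  Literature.NumberTheory.EllipticCurves Literature.NumberTheory.EllipticCurves.ModularForms
  Literature.NumberTheory.EllipticCurves.Rank1Residual
  Literature.NumberTheory.EllipticCurves.Hsieh2014
  Literature.NumberTheory.EllipticCurves.GreenbergSelmer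
  Literature.NumberTheory.EllipticCurves.Module
  Literature.NumberTheory.EllipticCurves.IwasawaDual
  Literature.NumberTheory.GaloisRepresentations
  Summit.BirchSwinnertonDyer.Rank1Residual Summit.BirchSwinnertonDyer.Rank1Residual.X11b
  Summit.BirchSwinnertonDyer.Rank1Residual.X11b.AcSelmer
  Summit.BirchSwinnertonDyer.BirchSwinnertonDyer.Theorems.BiquadraticEisensteinDescentDefs
  Summit.BirchSwinnertonDyer.BirchSwinnertonDyer.Theorems.BiquadraticEisensteinDescentEisensteinHeartFlatCMInertBadKPrimeSelmerTower
  Summit.BirchSwinnertonDyer.BirchSwinnertonDyer.Theorems.BiquadraticEisensteinDescentEisensteinHeartFlatCMInertBadKPrimeShapiroDatum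
  Summit.BirchSwinnertonDyer.BirchSwinnertonDyer.Theorems.BiquadraticEisensteinDescentEisensteinHeartFlatCMInertBadKPrimeCMDatumAdapter

namespace Summit.BirchSwinnertonDyer.BirchSwinnertonDyer.Cruxes.EisensteinHeartFlatCMInertBadKPrime.PromoteV4K

open Summit.BirchSwinnertonDyer.BirchSwinnertonDyer.Theses.BiquadraticEisensteinDescent

/-- The proposed crux child `EisensteinDivisibilityKatzLineCMInertBad` (= registered `stub_V4K` of line `hsieh_lambda` v3, verbatim):
for the crux data `(W, p, K′, κ, γ, 𝔭, f, ι′, 𝔭′)` with `X_ac(W/K′)_{𝔭′-str}` torsion, every TIED Katz line frame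
`(L, Sp, S, T, λ, ϑ, C_K, Ω, Ω′_p, G, w₁, w₂, c_L, c_L′)` (Katz type, continuation, the Rankin–Selberg tie, ramification, non-vanishing,
`KatzCM.IsBaseChangeLine`), every `[√d₀]` datum `(d₀, r, ψ)` with `U = Stab(r)`, and every admissible Selmer datum
`(φ, γ′, f₁, h, δ, b, ι)`: `∃ m, p^m · Ch_{𝒪⟦T⟧}(N) · 𝓞_ℂp⟦T⟧ ⊆ (G)` for the `ψ_L`-branch module `N` (`WithQuadratic (LocNilDual …)`).
Research statement (NOT in print on the p-ramified branch); see the module docstring. -/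
def EisensteinDivisibilityKatzLineCMInertBad : Prop :=
    ∀ (W : WeierstrassCurve ℚ) [W.IsElliptic] [W.IsGloballyMinimal] (p : ℕ) [Fact p.Prime]
      [NeZero (W.conductorNorm ℤ)] (K : Type) [Field K] [NumberField K],
      W.HasCM → 5 ≤ p → CMInert W p → ¬ Good W p →
      IsImaginaryQuadratic K → SatisfiesHeegnerHypothesis (W.conductorNorm ℤ) K →
      4 < (NumberField.discr K).natAbs → ¬ p ∣ NumberField.classNumber K →
      ∀ (κ : ZpExtension K p), κ.IsAnticyclotomic →
        ∀ (γ : Field.absoluteGaloisGroup K) [Fact (κ.IsTopGenerator γ)]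
          (𝔭 : HeightOneSpectrum (𝓞 K)), ((p : ℕ) : 𝓞 K) ∈ 𝔭.asIdeal →
          𝔭.asIdeal.ramificationIdx (𝓞 ℚ) = 1 → 𝔭.asIdeal.inertiaDeg (𝓞 ℚ) = 1 →
          ∀ (f : CuspForm (CongruenceSubgroup.Gamma0 (W.conductorNorm ℤ)) 2), IsNewformOf W f →
            ∀ (ι' : PadicAlgCl p ≃+* ℂ),
              (∀ (w : InfinitePlace K) (k : 𝓞 K), k ∈ 𝔭.asIdeal ↔ ‖ι'.symm (w.embedding (k : K))‖ < 1) →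
                  ∀ (𝔭' : HeightOneSpectrum (𝓞 K)), ((p : ℕ) : 𝓞 K) ∈ 𝔭'.asIdeal → 𝔭' ≠ 𝔭 →
                  Module.IsTorsion (IwasawaAlgebra p) (XAc (W.baseChange K) p κ 𝔭' ∅ γ) →
                  ∀ (L : Type) [Field L] [NumberField L] [Algebra K L] [IsGalois K L]
                    (Sp S T : Finset (HeightOneSpectrum (𝓞 L))) (lam : HeckeCharacter L) (ϑ : L) (CK : ℂ)
                    (Ω : InfinitePlace L → ℂ) (ΩpK : InfinitePlace L → ℂ_[p]) (G : PowerSeries 𝓞_ℂ_[p])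
                    (w₁ w₂ : InfinitePlace L) (cL cL' : ℂ),
                    w₁ ≠ w₂ → (∀ w : InfinitePlace L, w = w₁ ∨ w = w₂) →
                    (∀ (χ : HeckeCharacter K) (n : ℕ), 0 < n → (∀ v : HeightOneSpectrum (𝓞 K), χ.IsUnramifiedAt v) →
                      χ.HasInfinityType (fun _ ↦ (n : ℤ)) (fun _ ↦ -(n : ℤ)) →
                      KatzCM.HasKatzType ι' Sp (lam * χ.compRelNorm L) 1 (fun w ↦ if w = w₁ then n else n - 1)) →
                    (∀ (χ : HeckeCharacter K) (n : ℕ), 0 < n → (∀ v : HeightOneSpectrum (𝓞 K), χ.IsUnramifiedAt v) →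
                      χ.HasInfinityType (fun _ ↦ (n : ℤ)) (fun _ ↦ -(n : ℤ)) →
                      LFunction.HasEntireContinuation (heckeLFunction (lam * χ.compRelNorm L))) →
                    cL ≠ 0 → cL' ≠ 0 →
                    (∀ (χ : HeckeCharacter K) (n : ℕ), 0 < n → (∀ v : HeightOneSpectrum (𝓞 K), χ.IsUnramifiedAt v) →
                      χ.HasInfinityType (fun _ ↦ (n : ℤ)) (fun _ ↦ -(n : ℤ)) →
                      ∀ hL : LFunction.HasEntireContinuation (heckeLFunction (lam * χ.compRelNorm L)),
                        hL.continuation 0 = cL * cL' ^ n * rankinSelbergValueHecke f χ 1) →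
                    (∀ w ∈ S ∪ KatzCM.primesOver L p, ¬ lam.IsUnramifiedAt w) →
                    (∀ w ∈ Sp ∪ T, ¬ lam.IsUnramifiedAt w) →
                    CK ≠ 0 → (∀ w, Ω w ≠ 0) → (∀ w, (KatzCM.embeddingAt ι' Sp w ϑ).im ≠ 0) → (∀ w, ΩpK w ≠ 0) →
                    KatzCM.IsBaseChangeLine ι' Sp S T κ γ lam ϑ CK Ω ΩpK G →
                  ∀ (d₀ : ℤ) (r : AlgebraicClosure K) (ψ : (W.baseChange K).geomPoints →+ (W.baseChange K).geomPoints),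
                    r * r = algebraMap K (AlgebraicClosure K) (d₀ : K) →
                    r ∉ Set.range (algebraMap K (AlgebraicClosure K)) →
                    (∀ y : ZMod p, y * y ≠ PadicInt.toZMod ((d₀ : ℤ) : ℤ_[p])) →
                    (∀ σ : absoluteGaloisGroup K, σ • r = r → ∀ P : (W.baseChange K).geomPoints, σ • ψ P = ψ (σ • P)) →
                    (∀ σ : absoluteGaloisGroup K, σ • r = -r → ∀ P : (W.baseChange K).geomPoints, σ • ψ P = -ψ (σ • P)) →
                    (∀ P, ψ (ψ P) = d₀ • P) →
                  ∀ (U : Subgroup (absoluteGaloisGroup K)) [U.Normal], (∀ σ, σ ∈ U ↔ σ • r = r) →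
                  ∀ (φ : (W.baseChange K).geomPrimaryTorsion p →+ (W.baseChange K).geomPrimaryTorsion p)
                    (_ : ∀ m, ((φ m : (W.baseChange K).geomPrimaryTorsion p) : (W.baseChange K).geomPoints) = ψ m)
                    (hφH' : ∀ (x : (κ.kerSubgroup ⊓ U : Subgroup (absoluteGaloisGroup K)))
                      (m : (W.baseChange K).geomPrimaryTorsion p), φ (x • m) = x • φ m)
                    (hφU : ∀ σ ∈ U, ∀ m : (W.baseChange K).geomPrimaryTorsion p, φ (σ • m) = σ • φ m)
                    (hφU' : ∀ σ, σ ∉ U → ∀ m : (W.baseChange K).geomPrimaryTorsion p, φ (σ • m) = -(σ • φ m))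
                    (hφ2 : ∀ m, φ (φ m) = d₀ • m)
                    (γ' : absoluteGaloisGroup K) (_ : κ.IsTopGenerator γ') (_ : γ' ∈ U)
                    (f₁ : AddMonoid.End (selmerOver (κ.kerSubgroup ⊓ U) ((W.baseChange K).geomPrimaryTorsion p) p 𝔭' ∅))
                    (_hf : ∀ s, ((f₁ s : selmerOver (κ.kerSubgroup ⊓ U) ((W.baseChange K).geomPrimaryTorsion p) p 𝔭' ∅) :
                      subgroupH1 (κ.kerSubgroup ⊓ U) ((W.baseChange K).geomPrimaryTorsion p)) =
                        conjH1 (κ.kerSubgroup ⊓ U) ((W.baseChange K).geomPrimaryTorsion p) γ' s)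
                    (h : IsLocNil p (f₁ - 1))
                    (δ : LocNilDual (selmerOver (κ.kerSubgroup ⊓ U) ((W.baseChange K).geomPrimaryTorsion p) p 𝔭' ∅) f₁ h
                      →ₗ[IwasawaAlgebra p]
                      LocNilDual (selmerOver (κ.kerSubgroup ⊓ U) ((W.baseChange K).geomPrimaryTorsion p) p 𝔭' ∅) f₁ h)
                    (hδ : ∀ (x : LocNilDual (selmerOver (κ.kerSubgroup ⊓ U) ((W.baseChange K).geomPrimaryTorsion p) p 𝔭' ∅) f₁ h)
                      (s t : selmerOver (κ.kerSubgroup ⊓ U) ((W.baseChange K).geomPrimaryTorsion p) p 𝔭' ∅),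
                      (t : subgroupH1 (κ.kerSubgroup ⊓ U) ((W.baseChange K).geomPrimaryTorsion p)) =
                        resH1Hom (ContinuousMonoidHom.id _) φ hφH'
                          (s : subgroupH1 (κ.kerSubgroup ⊓ U) ((W.baseChange K).geomPrimaryTorsion p)) → δ x s = x t)
                    (b : Module.Basis (Fin 2) ℤ_[p]
                      (AdjoinRoot (Polynomial.X ^ 2 - Polynomial.C ((d₀ : ℤ) : ℤ_[p]) : Polynomial ℤ_[p]))) (hb0 : b 0 = 1)
                    (hb1 : b 1 * b 1 = algebraMap ℤ_[p]
                      (AdjoinRoot (Polynomial.X ^ 2 - Polynomial.C ((d₀ : ℤ) : ℤ_[p]) : Polynomial ℤ_[p])) ((d₀ : ℤ) : ℤ_[p]))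
                    (ι : AdjoinRoot (Polynomial.X ^ 2 - Polynomial.C ((d₀ : ℤ) : ℤ_[p]) : Polynomial ℤ_[p]) →+* 𝓞_ℂ_[p])
                    (_ : ι.comp (algebraMap ℤ_[p] _) = R1.toCpInt p),
                    ∃ m : ℕ, ∀ x ∈ (charIdeal (PowerSeries
                        (AdjoinRoot (Polynomial.X ^ 2 - Polynomial.C ((d₀ : ℤ) : ℤ_[p]) : Polynomial ℤ_[p])))
                        (WithQuadratic (LocNilDual (selmerOver (κ.kerSubgroup ⊓ U) ((W.baseChange K).geomPrimaryTorsion p)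
                          p 𝔭' ∅) f₁ h) b hb0 hb1 δ
                          (delta_sq (W.baseChange K) κ 𝔭' ∅ U φ hφH' hφU hφU' d₀ hφ2 f₁ h δ hδ))).map (PowerSeries.map ι),
                      (PowerSeries.C ((p : ℕ) : 𝓞_ℂ_[p]) : PowerSeries 𝓞_ℂ_[p]) ^ m * x ∈ Ideal.span {G}

/-- GLUE of the split (kernel-checked): the crux `EisensteinHeartFlatCMInertBadKPrime` BY NAME from the three print facts
(A) Hsieh Doc. Math. 19 (2014) Thm A at any level, (Katz) existence of the Katz measure, (Deuring) the Grössencharacter of a CM curve,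
and the proposed crux child `EisensteinDivisibilityKatzLineCMInertBad` — by the landed reduction p647756. -/
theorem eisensteinHeartFlatCMInertBadKPrime_of_inputs
    (hA : Literature.NumberTheory.EllipticCurves.Hsieh2014.thmA_exists_isHsiehLFunction_unrPeriod_anyLevel)
    (hKatz : hsieh2014mu_prop49_exists_isMeasure) (hD : Deuring_exists_heckeCharacter_of_maximalCM)
    (hV : EisensteinDivisibilityKatzLineCMInertBad) : EisensteinHeartFlatCMInertBadKPrime :=
  Summit.BirchSwinnertonDyer.BirchSwinnertonDyer.Theorems.BiquadraticEisensteinDescentEisensteinHeartFlatCMInertBadKPrimeOfV4K.eisensteinHeartFlatCMInertBadKPrime_of_V4K_of_facts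
    hA hKatz hD hV

/-- The registered stub and the proposed child are the same statement (by `Iff.rfl`), for the record. -/
theorem eisensteinDivisibilityKatzLineCMInertBad_iff_stub_V4K :
    EisensteinDivisibilityKatzLineCMInertBad ↔
    (∀ (W : WeierstrassCurve ℚ) [W.IsElliptic] [W.IsGloballyMinimal] (p : ℕ) [Fact p.Prime]
      [NeZero (W.conductorNorm ℤ)] (K : Type) [Field K] [NumberField K],
      W.HasCM → 5 ≤ p → CMInert W p → ¬ Good W p →
      IsImaginaryQuadratic K → SatisfiesHeegnerHypothesis (W.conductorNorm ℤ) K →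
      4 < (NumberField.discr K).natAbs → ¬ p ∣ NumberField.classNumber K →
      ∀ (κ : ZpExtension K p), κ.IsAnticyclotomic →
        ∀ (γ : Field.absoluteGaloisGroup K) [Fact (κ.IsTopGenerator γ)]
          (𝔭 : HeightOneSpectrum (𝓞 K)), ((p : ℕ) : 𝓞 K) ∈ 𝔭.asIdeal →
          𝔭.asIdeal.ramificationIdx (𝓞 ℚ) = 1 → 𝔭.asIdeal.inertiaDeg (𝓞 ℚ) = 1 →
          ∀ (f : CuspForm (CongruenceSubgroup.Gamma0 (W.conductorNorm ℤ)) 2), IsNewformOf W f →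
            ∀ (ι' : PadicAlgCl p ≃+* ℂ),
              (∀ (w : InfinitePlace K) (k : 𝓞 K), k ∈ 𝔭.asIdeal ↔ ‖ι'.symm (w.embedding (k : K))‖ < 1) →
                  ∀ (𝔭' : HeightOneSpectrum (𝓞 K)), ((p : ℕ) : 𝓞 K) ∈ 𝔭'.asIdeal → 𝔭' ≠ 𝔭 →
                  Module.IsTorsion (IwasawaAlgebra p) (XAc (W.baseChange K) p κ 𝔭' ∅ γ) →
                  ∀ (L : Type) [Field L] [NumberField L] [Algebra K L] [IsGalois K L]
                    (Sp S T : Finset (HeightOneSpectrum (𝓞 L))) (lam : HeckeCharacter L) (ϑ : L) (CK : ℂ)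
                    (Ω : InfinitePlace L → ℂ) (ΩpK : InfinitePlace L → ℂ_[p]) (G : PowerSeries 𝓞_ℂ_[p])
                    (w₁ w₂ : InfinitePlace L) (cL cL' : ℂ),
                    w₁ ≠ w₂ → (∀ w : InfinitePlace L, w = w₁ ∨ w = w₂) →
                    (∀ (χ : HeckeCharacter K) (n : ℕ), 0 < n → (∀ v : HeightOneSpectrum (𝓞 K), χ.IsUnramifiedAt v) →
                      χ.HasInfinityType (fun _ ↦ (n : ℤ)) (fun _ ↦ -(n : ℤ)) →
                      KatzCM.HasKatzType ι' Sp (lam * χ.compRelNorm L) 1 (fun w ↦ if w = w₁ then n else n - 1)) →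
                    (∀ (χ : HeckeCharacter K) (n : ℕ), 0 < n → (∀ v : HeightOneSpectrum (𝓞 K), χ.IsUnramifiedAt v) →
                      χ.HasInfinityType (fun _ ↦ (n : ℤ)) (fun _ ↦ -(n : ℤ)) →
                      LFunction.HasEntireContinuation (heckeLFunction (lam * χ.compRelNorm L))) →
                    cL ≠ 0 → cL' ≠ 0 →
                    (∀ (χ : HeckeCharacter K) (n : ℕ), 0 < n → (∀ v : HeightOneSpectrum (𝓞 K), χ.IsUnramifiedAt v) →
                      χ.HasInfinityType (fun _ ↦ (n : ℤ)) (fun _ ↦ -(n : ℤ)) →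
                      ∀ hL : LFunction.HasEntireContinuation (heckeLFunction (lam * χ.compRelNorm L)),
                        hL.continuation 0 = cL * cL' ^ n * rankinSelbergValueHecke f χ 1) →
                    (∀ w ∈ S ∪ KatzCM.primesOver L p, ¬ lam.IsUnramifiedAt w) →
                    (∀ w ∈ Sp ∪ T, ¬ lam.IsUnramifiedAt w) →
                    CK ≠ 0 → (∀ w, Ω w ≠ 0) → (∀ w, (KatzCM.embeddingAt ι' Sp w ϑ).im ≠ 0) → (∀ w, ΩpK w ≠ 0) →
                    KatzCM.IsBaseChangeLine ι' Sp S T κ γ lam ϑ CK Ω ΩpK G →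
                  ∀ (d₀ : ℤ) (r : AlgebraicClosure K) (ψ : (W.baseChange K).geomPoints →+ (W.baseChange K).geomPoints),
                    r * r = algebraMap K (AlgebraicClosure K) (d₀ : K) →
                    r ∉ Set.range (algebraMap K (AlgebraicClosure K)) →
                    (∀ y : ZMod p, y * y ≠ PadicInt.toZMod ((d₀ : ℤ) : ℤ_[p])) →
                    (∀ σ : absoluteGaloisGroup K, σ • r = r → ∀ P : (W.baseChange K).geomPoints, σ • ψ P = ψ (σ • P)) →
                    (∀ σ : absoluteGaloisGroup K, σ • r = -r → ∀ P : (W.baseChange K).geomPoints, σ • ψ P = -ψ (σ • P)) →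
                    (∀ P, ψ (ψ P) = d₀ • P) →
                  ∀ (U : Subgroup (absoluteGaloisGroup K)) [U.Normal], (∀ σ, σ ∈ U ↔ σ • r = r) →
                  ∀ (φ : (W.baseChange K).geomPrimaryTorsion p →+ (W.baseChange K).geomPrimaryTorsion p)
                    (_ : ∀ m, ((φ m : (W.baseChange K).geomPrimaryTorsion p) : (W.baseChange K).geomPoints) = ψ m)
                    (hφH' : ∀ (x : (κ.kerSubgroup ⊓ U : Subgroup (absoluteGaloisGroup K)))
                      (m : (W.baseChange K).geomPrimaryTorsion p), φ (x • m) = x • φ m)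
                    (hφU : ∀ σ ∈ U, ∀ m : (W.baseChange K).geomPrimaryTorsion p, φ (σ • m) = σ • φ m)
                    (hφU' : ∀ σ, σ ∉ U → ∀ m : (W.baseChange K).geomPrimaryTorsion p, φ (σ • m) = -(σ • φ m))
                    (hφ2 : ∀ m, φ (φ m) = d₀ • m)
                    (γ' : absoluteGaloisGroup K) (_ : κ.IsTopGenerator γ') (_ : γ' ∈ U)
                    (f₁ : AddMonoid.End (selmerOver (κ.kerSubgroup ⊓ U) ((W.baseChange K).geomPrimaryTorsion p) p 𝔭' ∅))
                    (_hf : ∀ s, ((f₁ s : selmerOver (κ.kerSubgroup ⊓ U) ((W.baseChange K).geomPrimaryTorsion p) p 𝔭' ∅) :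
                      subgroupH1 (κ.kerSubgroup ⊓ U) ((W.baseChange K).geomPrimaryTorsion p)) =
                        conjH1 (κ.kerSubgroup ⊓ U) ((W.baseChange K).geomPrimaryTorsion p) γ' s)
                    (h : IsLocNil p (f₁ - 1))
                    (δ : LocNilDual (selmerOver (κ.kerSubgroup ⊓ U) ((W.baseChange K).geomPrimaryTorsion p) p 𝔭' ∅) f₁ h
                      →ₗ[IwasawaAlgebra p]
                      LocNilDual (selmerOver (κ.kerSubgroup ⊓ U) ((W.baseChange K).geomPrimaryTorsion p) p 𝔭' ∅) f₁ h)
                    (hδ : ∀ (x : LocNilDual (selmerOver (κ.kerSubgroup ⊓ U) ((W.baseChange K).geomPrimaryTorsion p) p 𝔭' ∅) f₁ h)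
                      (s t : selmerOver (κ.kerSubgroup ⊓ U) ((W.baseChange K).geomPrimaryTorsion p) p 𝔭' ∅),
                      (t : subgroupH1 (κ.kerSubgroup ⊓ U) ((W.baseChange K).geomPrimaryTorsion p)) =
                        resH1Hom (ContinuousMonoidHom.id _) φ hφH'
                          (s : subgroupH1 (κ.kerSubgroup ⊓ U) ((W.baseChange K).geomPrimaryTorsion p)) → δ x s = x t)
                    (b : Module.Basis (Fin 2) ℤ_[p]
                      (AdjoinRoot (Polynomial.X ^ 2 - Polynomial.C ((d₀ : ℤ) : ℤ_[p]) : Polynomial ℤ_[p]))) (hb0 : b 0 = 1)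
                    (hb1 : b 1 * b 1 = algebraMap ℤ_[p]
                      (AdjoinRoot (Polynomial.X ^ 2 - Polynomial.C ((d₀ : ℤ) : ℤ_[p]) : Polynomial ℤ_[p])) ((d₀ : ℤ) : ℤ_[p]))
                    (ι : AdjoinRoot (Polynomial.X ^ 2 - Polynomial.C ((d₀ : ℤ) : ℤ_[p]) : Polynomial ℤ_[p]) →+* 𝓞_ℂ_[p])
                    (_ : ι.comp (algebraMap ℤ_[p] _) = R1.toCpInt p),
                    ∃ m : ℕ, ∀ x ∈ (charIdeal (PowerSeries
                        (AdjoinRoot (Polynomial.X ^ 2 - Polynomial.C ((d₀ : ℤ) : ℤ_[p]) : Polynomial ℤ_[p])))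
                        (WithQuadratic (LocNilDual (selmerOver (κ.kerSubgroup ⊓ U) ((W.baseChange K).geomPrimaryTorsion p)
                          p 𝔭' ∅) f₁ h) b hb0 hb1 δ
                          (delta_sq (W.baseChange K) κ 𝔭' ∅ U φ hφH' hφU hφU' d₀ hφ2 f₁ h δ hδ))).map (PowerSeries.map ι),
                      (PowerSeries.C ((p : ℕ) : 𝓞_ℂ_[p]) : PowerSeries 𝓞_ℂ_[p]) ^ m * x ∈ Ideal.span {G}) :=
  Iff.rfl

end Summit.BirchSwinnertonDyer.BirchSwinnertonDyer.Cruxes.EisensteinHeartFlatCMInertBadKPrime.PromoteV4K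

end
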